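import Summits.BirchSwinnertonDyer.BirchSwinnertonDyer.Theses.TameQuarticManinParity
import Summits.BirchSwinnertonDyer.BirchSwinnertonDyer.Theorems.TameQuarticManinParityTwistPairAtThree
import Summits.BirchSwinnertonDyer.Rank1Residual.O6.X3WildOfKMCTorsionFreeMember
import HarnessLib

/-!
# Route `TameQuarticManinParity`, LINE 22 (bsd-idea-3 g8), support S22 `TprimeIrrManinLeOfOrientation`
# (stmt-BirchSwinnertonDyer-28140) — PROVED BY NAME: with the orientation `Λ(f) ⊆ g(χ₋₃)·Λ(f ⊗ χ₋₃)` the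
# one-sided Gauss-sum transport of the Manin `3`-part loses its slack on the Kodaira-III side

Cell `pub/bsd-wall`, D-0145 line `route-BirchSwinnertonDyer-TeichmullerTwistDescent`, seat `bsd-line-ttd-p1` g9,
working the planner-of-record's TQMP LINE 22. BSD is NOT proved by this; Manin's conjecture is not proved by this;
the orientation O22 (`TprimeIrrTwistLatticeOrientation`) and the existence X22 stay OPEN: this file proves the
TRANSPORT given the orientation as a hypothesis (it is a binder of the item).

## Statement (the route decl, paraphrased)

`W/ℚ` globally minimal, (t′) at `3` of Kodaira type III (`ord₃ Δ_min(W) = 3`), `D` a LATTICE-OPTIMAL conductor-level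
datum (`Λ_W = c·Λ_N(f)`, `N = N(W)`) whose newform satisfies the ORIENTATION `Λ_N(f) ⊆ g(χ)·Λ_N(f ⊗ χ)` for the
primitive quadratic characters `χ` mod `3`; `A/ℚ` globally minimal with `ord₃ Δ_min(A) = 9` and `A ⊗ ℚ(√−3) ∼ W`;
`D'` ANY datum of `A` at a level `N' ∣ N`. Then `3 ∤ c(D') ⟹ 3 ∤ c(D)`.

## Proof (Stevens' chain run along the orientation instead of against it)

Let `V = C • (W ⊗ χ₋₃)` be globally minimal; since `ord₃ Δ_min(W) = 3 < 6` the scaling is a `3`-unit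
(`TwistPairAtThree.padicValRat_u_eq_zero_of_III`) and `Λ_V = u·g⁻¹·Λ_W` (`g = g(χ₃)`). The newform `f` of `W` and the
newform `f'` of `A` satisfy `aₙ(f) = χ(n)aₙ(f')`, `aₙ(f') = χ(n)aₙ(f)` (`A ⊗ χ₋₃ ∼ W`, both curves additive at
`3`), so the level-`N` twist `f ⊗ χ` IS `f'` raised to level `N` (q-expansion principle) and `Λ_N(f ⊗ χ) ⊆ Λ_{N'}(f')`
(Stevens' twisting lemma with the trivial character, `g(𝟙) = 1`). For `x ∈ Λ_V`: `g u⁻¹ x = c·w ∈ Λ_W`, `w = g·w₁`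
with `w₁ ∈ Λ_N(f ⊗ χ)` (ORIENTATION), hence `x = u c w₁` and `(c'/(u c))·x = c' w₁ ∈ Λ_A`. The rational scaling
`c'/(u c) : Λ_V → Λ_A` between globally minimal curves is integral (Néron mapping property), so
`ord₃ c ≤ ord₃ c' − ord₃ u = ord₃ c'`. (The binder `ord₃ Δ_min(A) = 9` is displayed, not used.) Design: theorems
only; no definition, no named fact, no `sorry`; axioms `propext`, `Classical.choice`, `Quot.sound`. References:
[Stevens1989] Lemmas (5.2), (5.4), (5.5); [EdixhovenManin1991] §4; [Pal2012] Prop. 2.5, Lemma 3.1.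
-/

set_option autoImplicit false
-- D-0017: single-problem summit, so `Summit.BirchSwinnertonDyer.BirchSwinnertonDyer.…` repeats a namespace BY DESIGN.
set_option linter.dupNamespace false

noncomputable section

open scoped Classical NumberField

namespace Summit.BirchSwinnertonDyer.BirchSwinnertonDyer.Theorems.TameQuarticManinParity

open WeierstrassCurve IsDedekindDomain Rat.HeightOneSpectrum
  Literature.NumberTheory.EllipticCurves Literature.NumberTheory.EllipticCurves.ModularForms
  Literature.NumberTheory.EllipticCurves.Rank1Residual
  Summit.BirchSwinnertonDyer.Rank1Residual Summit.BirchSwinnertonDyer.Rank1Residual.Additive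
  Summit.BirchSwinnertonDyer.Rank1Residual.ManinAdditive
  Summit.BirchSwinnertonDyer.BirchSwinnertonDyer.Theses.TameQuarticManinParity

/-! ## §1 Small facts -/

/-- **`Γ₀(N)`-periods are `Γ₀(N')`-periods**: for `f' ∈ S₂(Γ₀(N'))`, `N' ∣ N`, the period lattice of `f'` raised
to level `N` (the twist by the trivial character) lies in `Λ_{N'}(f')` — Stevens' twisting lemma with `g(𝟙) = 1`.
[cite: Stevens1989, Lemma (5.4) p. 97] -/
theorem periodLattice_charTwist_one_le {N' N : ℕ} [NeZero N'] [NeZero N] (hN : N' ∣ N)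
    (f' : CuspForm (CongruenceSubgroup.Gamma0 N') 2) {z : ℂ}
    (hz : z ∈ periodLattice (charTwist N hN (by norm_num) maninLocalTwoThree_isQuadratic_one_level_one f')) :
    z ∈ periodLattice f' := by
  have h := gaussSum_mul_mem_periodLattice_of_mem_charTwist N hN (by norm_num)
    maninLocalTwoThree_isQuadratic_one_level_one DirichletCharacter.isPrimitive_one_level_one f' hz
  rwa [maninLocalTwoThree_gaussSum_one_level_one, one_mul] at h

/-- **A globally minimal `A` with `ord₃ Δ_min(A) = 9` whose `χ₋₃`-twist has potentially good reduction at `3` is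
additive at `3`** (`3 ∣ Δ_min`: not good; `ord₃ j ≥ 0`: not multiplicative). [cite: SilvermanAEC2009, VII.5 Prop. 5.1] -/
theorem addv_three_of_nine_of_j_nonneg (A : WeierstrassCurve ℚ) [A.IsElliptic] [A.IsGloballyMinimal]
    (h9 : padicValInt 3 A.minimalDiscriminantInt = 9) (hj : 0 ≤ padicValRat 3 A.j) : Addv A 3 := by
  refine ⟨not_hasGoodReductionAtPrime_of_dvd_minimalDiscriminantInt A 3 ?_, fun hm ↦ ?_⟩
  · have h : ((3 : ℕ) : ℤ) ^ 1 ∣ A.minimalDiscriminantInt :=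
      (padicValInt_dvd_iff 1 _).mpr (Or.inr (by omega))
    simpa using h
  · exact absurd (EisensteinPrimes.padicValRat_j_neg_of_mult A 3 hm) (not_lt.mpr hj)

/-! ## §2 S22 by name -/

/-- **S22 `TprimeIrrManinLeOfOrientation` (stmt-BirchSwinnertonDyer-28140), by name.** See the module docstring:
Stevens' `Γ₀` chain along the orientation, the twist dictionary `Λ_V = u g⁻¹ Λ_A` with `ord₃ u = 1` (the III*
partner's twist is not minimal at `3`), and the Néron mapping property. [cite: Stevens1989, Lemmas (5.2), (5.4)]
[cite: EdixhovenManin1991, §4] [cite: Pal2012, Prop. 2.5 and Lemma 3.1] -/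
theorem tprimeIrrManinLeOfOrientation_proof : TprimeIrrManinLeOfOrientation := by
  intro W _ _ _ hadd ht h3 D hopt hO A _ _ _h9A hAW N' _ D' hN' hc'
  -- notation
  have hp2 : (3 : ℕ) ≠ 2 := by norm_num
  have e : ((-1 : ℚ) ^ (3 / 2) * 3) = -3 := by norm_num
  have ecast : ((((-1 : ℤ) ^ (3 / 2) * (3 : ℕ) : ℤ)) : ℚ) = (-1 : ℚ) ^ (3 / 2) * 3 := by norm_num
  have hd0 : ((-1 : ℚ) ^ (3 / 2) * 3) ≠ 0 := by norm_num
  haveI hAt : (A.quadraticTwist ((-1 : ℚ) ^ (3 / 2) * 3)).IsElliptic := A.isElliptic_quadraticTwist hd0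
  haveI hWt : (W.quadraticTwist ((-1 : ℚ) ^ (3 / 2) * 3)).IsElliptic := W.isElliptic_quadraticTwist hd0
  have hAW' : IsIsogenous (A.quadraticTwist ((-1 : ℚ) ^ (3 / 2) * 3)) W := by rw [e]; exact hAW
  -- §a `A` is additive at `3`: `j(A) = j(A ⊗ χ₋₃)` and `A ⊗ χ₋₃ ∼ W` is potentially good at `3`
  have hjW : 0 ≤ padicValRat 3 W.j := not_lt.mp ht.1
  have hjA : 0 ≤ padicValRat 3 A.j := by
    rw [← A.j_quadraticTwist hd0]
    exact (Addv.of_isIsogenous_of_padicValRat_j_nonneg hadd hjW hAW'.symm_of_charZero).2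
  have haddA : Addv A 3 := addv_three_of_nine_of_j_nonneg A _h9A hjA
  have hA0 : ∀ n : ℕ, 3 ∣ n → A.LFunction n = 0 := fun n hn ↦
    A.LFunction_apply_eq_zero_of_not_good_of_not_mult 3 haddA.1 haddA.2 hn
  have hW0 : ∀ n : ℕ, 3 ∣ n → W.LFunction n = 0 := fun n hn ↦
    W.LFunction_apply_eq_zero_of_not_good_of_not_mult 3 hadd.1 hadd.2 hn
  -- §b the coefficient relations `aₙ(f) = χ(n) aₙ(f')`, `aₙ(f') = χ(n) aₙ(f)`
  set χ : DirichletCharacter ℂ 3 := (quadraticChar (ZMod 3)).ringHomComp (Int.castRingHom ℂ) with hχ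
  have hχq : χ.IsQuadratic := isQuadratic_quadraticChar_ringHomComp 3
  have hχp : χ.IsPrimitive := isPrimitive_quadraticChar_ringHomComp 3 hp2
  have h1 : (1 : VariableChange ℚ) • A.quadraticTwist ((((-1 : ℤ) ^ (3 / 2) * (3 : ℕ) : ℤ)) : ℚ) =
      A.quadraticTwist ((-1 : ℚ) ^ (3 / 2) * 3) := by rw [one_smul, ecast]
  have hLA : (A.quadraticTwist ((-1 : ℚ) ^ (3 / 2) * 3)).LFunction = W.LFunction :=
    LFunction_eq_of_isIsogenous_holds _ W hAW'
  have hcoef : ∀ n : ℕ, cuspCoeff D.f n = χ n * cuspCoeff D'.f n := fun n ↦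
    cuspCoeff_eq_chi_mul_of_twist_pStar hp2 1 h1 hLA hW0 D' D n
  have hcoef' : ∀ n : ℕ, cuspCoeff D'.f n = χ n * cuspCoeff D.f n := fun n ↦
    cuspCoeff_eq_chi_mul_of_twist_pStar' hp2 1 h1 hLA hA0 D' D n
  -- §c `f ⊗ χ` (level `N`) is `f'` raised to level `N`
  have h9N : 3 ^ 2 ∣ W.conductorNorm ℤ := TwistPairAtThree.nine_dvd_conductorNorm_of_addv W hadd
  set F := charTwist (W.conductorNorm ℤ) (dvd_refl _) h9N hχq D.f with hF
  set G := charTwist (W.conductorNorm ℤ) hN' (by norm_num) maninLocalTwoThree_isQuadratic_one_level_one D'.f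
    with hG
  have hFG : F = G := by
    refine eq_of_forall_cuspCoeff_eq_gamma0 fun n ↦ ?_
    rw [hF, hG, cuspCoeff_charTwist _ _ _ hχq hχp, cuspCoeff_charTwist _ _ _
      maninLocalTwoThree_isQuadratic_one_level_one DirichletCharacter.isPrimitive_one_level_one,
      MulChar.one_apply (isUnit_of_subsingleton (M := ZMod 1) (n : ZMod 1)), one_mul, hcoef n, ← mul_assoc]
    rcases hχq n with h0 | h1 | h1
    · rw [h0, zero_mul, zero_mul]
      have : cuspCoeff D'.f n = χ n * cuspCoeff D.f n := hcoef' n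
      rw [this, h0, zero_mul]
    · rw [h1, one_mul, one_mul]
    · rw [h1]; ring
  -- §d the globally minimal model `V` of `W ⊗ χ₋₃`: `ord₃ u = 0`, `Λ_V = u g⁻¹ Λ_W`
  obtain ⟨C, hVmin⟩ := hasGlobalMinimalModel_rat_holds (W.quadraticTwist ((-1 : ℚ) ^ (3 / 2) * 3))
  set V := C • W.quadraticTwist ((-1 : ℚ) ^ (3 / 2) * 3) with hV
  have hC : C • W.quadraticTwist ((-1 : ℚ) ^ (3 / 2) * 3) = V := rfl
  have hu : padicValRat 3 (C.u : ℚ) = 0 := (TwistPairAtThree.padicValRat_u_eq_zero_of_III W V C h3 hC).1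
  have hu0 : (C.u : ℚ) ≠ 0 := C.u.ne_zero
  obtain ⟨LV, hLVn⟩ := exists_isNeronLatticeOf_holds (V.baseChange ℂ)
  set Gs : ℂ := gaussSum χ (ZMod.stdAddChar (N := 3)) with hGs
  have hG2 : Gs ^ 2 = -3 := by
    rw [hGs, hχ, gaussSum_quadraticChar_ringHomComp_sq 3 hp2]; push_cast; norm_num
  have hGs0 : Gs ≠ 0 := by intro h; rw [h] at hG2; norm_num at hG2
  -- §e the chain: `(c' / (u c)) Λ_V ⊆ Λ_A`
  have hc0 : D.c ≠ 0 := D.maninConstant_ne_zero_holds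
  have hc0' : D'.c ≠ 0 := D'.maninConstant_ne_zero_holds
  set r : ℚ := 1 / (C.u : ℚ) with hr
  have hr0 : r ≠ 0 := div_ne_zero one_ne_zero hu0
  have key : ∀ x ∈ LV.lattice, (((r * D'.c / D.c : ℚ)) : ℂ) * x ∈ D'.L.lattice := by
    intro x hx
    rw [TeichmullerTwistDescentStarInvolution.mem_lattice_twist_pStar_iff 3 hp2 W V D.isNeronLattice hLVn C hC]
      at hx
    obtain ⟨w, hw, hxw⟩ := hopt _ hx
    obtain ⟨w₁, hw₁, rfl⟩ := hO h9N χ hχq hχp w hw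
    have hw₁' : w₁ ∈ periodLattice D'.f := by
      rw [← hF, hFG, hG] at hw₁
      exact periodLattice_charTwist_one_le hN' D'.f hw₁
    have h3 : (D'.c : ℂ) * w₁ ∈ D'.L.lattice := D'.smul_periodLattice_le _ hw₁'
    have hcℂ : (D.c : ℂ) ≠ 0 := by exact_mod_cast hc0
    have huℂ : ((C.u : ℚ) : ℂ) ≠ 0 := by exact_mod_cast hu0
    rw [← hGs] at hxw
    -- `x = u c w₁`
    have hx' : x = ((C.u : ℚ) : ℂ) * (D.c : ℂ) * w₁ := by
      have h := hxw
      field_simp at h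
      exact h
    rw [hx']
    convert h3 using 1
    rw [hr]
    push_cast
    field_simp
  -- §f integrality of the scaling and the valuation count
  obtain ⟨k, hk⟩ := integral_neronScaling_of_isGloballyMinimal_holds V A LV D'.L hLVn D'.isNeronLattice _ key
  have hcℚ : (D.c : ℚ) ≠ 0 := by exact_mod_cast hc0
  have hkc : r * D'.c = k * D.c := by
    rw [hk]; field_simp
  have hle := TeichmullerTwistDescentStarInvolution.padicValInt_le_of_int_mul_eq (p := 3) hr0 hc0 hc0' hkc
  have hrv : padicValRat 3 r = 0 := by
    rw [hr, padicValRat.div one_ne_zero hu0, hu, padicValRat.one]; norm_num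
  have hc'0 : padicValInt 3 D'.c = 0 := padicValInt.eq_zero_of_not_dvd hc'
  rw [hrv, hc'0] at hle
  push_cast at hle
  intro hdvd
  have h1 : 1 ≤ padicValInt 3 D.c := by
    have hdvd' : ((3 : ℕ) : ℤ) ^ 1 ∣ D.c := by simpa using (show (3 : ℤ) ∣ D.c from hdvd)
    exact ((padicValInt_dvd_iff 1 D.c).mp hdvd').resolve_left hc0
  omega

end Summit.BirchSwinnertonDyer.BirchSwinnertonDyer.Theorems.TameQuarticManinParity

end
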